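import Summits.QuantumFields.YangMills.Theorems.UV3AxialLaunderingFreeSlot
import HarnessLib

/-!
# R3 (cell `ym3-torus`, YM₃ on T³ — a ladder RUNG, NOT d = 4, NOT infinite volume, NOT a mass gap, NOT the Clay problem) —
# **FREE-SLOT LAUNDERING, SIGNED (BOCHNER) FORM: `∫ g(ŪU)·f(U) dU_j = (∫ g dU_{j+1})·(∫ f dU_j)` for every INTEGRABLE real `f` blind to one slot per segment and every bounded
# measurable test function `g` of the coarse field — the form a signed (Mayer ∕ inclusion–exclusion) step of a cluster expansion consumes**

Width seat `ym3-torus-px8` g12 on crux `stmt-QuantumFields-19936` `UnitScaleTilt.HistoryTailL` (`--supports`, helper; THEOREMS ONLY, 0 `def`, 0 `sorry`).  Sequel of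
✓`UV3AxialLaunderingFreeSlot` (p755566: the measure form for densities `f ≥ 0`).  In the N08 seat's (β4) design (`N08-HJ-LOOPPART-DESIGN-g47.md` §2) the resummation of the
non-firing constraints around a cluster is signed (inclusion–exclusion over the collar), so the laundering identity is needed for REAL integrands of both signs, as an identity of
Bochner integrals rather than of push-forward measures; this file supplies it by the same Tonelli∕Fubini route (slot shear + averaging over the coarse field), now with integrability
bookkeeping.

CONTENTS.  ★★★ `integral_comp_axialAvg_mul_eq_of_freeSlot` (the identity above; standing range; `f` integrable and slot-blind, `g` measurable and bounded);
★★ `integral_comp_axialAvg_mul_eq_of_readSet` (read-set form); `integral_comp_axialAvg_eq_of_freeSlot` (the case `f ≡ 1` is lit `map_axialAvg`; here: `g` bounded ⇒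
`∫ g(Ū(U·ext k))`-invariance, recorded as the inner step `integral_comp_axialAvg_shear`).

HONEST SCOPE.  [folklore] measure theory on lit `AveragingRT` objects; nothing of hTop ∕ (M4) ∕ hJ ∕ `HistoryTailL` (19936) ∕ the rung ∕ d = 4 ∕ a mass gap ∕ Clay is proved here.
YM₃ on T³ is rung R3 of the ladder, not the Clay problem.

References: T. Bałaban, Commun. Math. Phys. **109** (1987) 249–301 [Balaban1987RG1] ((0.4) p. 253); T. Bałaban, Commun. Math. Phys. **98** (1985) 17–51
[Balaban1985Averaging] ((10) p. 19).
-/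

set_option autoImplicit false

noncomputable section

open MeasureTheory
open scoped ENNReal

namespace Summit.QuantumFields.YangMills.Theorems.UV3AxialLaunderingFreeSlotIntegral

open Literature.MathematicalPhysics.QuantumFieldTheory.Balaban1983to89
open Literature.MathematicalPhysics.QuantumFieldTheory.Balaban1983to89.AveragingRT
open Summit.QuantumFields.YangMills.Theorems.UV3AxialLaunderingFreeSlot

variable {P : Params} {j : ℕ} {G : Type*} [GaugeGroup G] [MeasurableSpace G] [HaarData G] [MeasurableMul₂ G]

/-- **THE INNER STEP**: for fixed `U` and bounded measurable `g`, `∫ g(Ū(U·ext k)) dU_{j+1}(k) = ∫ g dU_{j+1}` (p755566 `measurePreserving_axialAvg_shear`). [folklore] -/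
theorem integral_comp_axialAvg_shear (hj : j + 1 ≤ P.m + P.K) (t : PBond P (j + 1) → ℕ) (ht : ∀ c, t c < P.L)
    (U : GaugeField P j G) {g : GaugeField P (j + 1) G → ℝ} (hg : Measurable g) :
    ∫ k, g (axialAvg (fun b => U b * Function.extend (fun c : PBond P (j + 1) => line c (t c)) k (fun _ => 1) b))
        ∂(fieldMeasure P (j + 1) G) = ∫ V, g V ∂(fieldMeasure P (j + 1) G) := by
  have hΛ := measurePreserving_axialAvg_shear (G := G) hj t ht U
  have h := integral_map (μ := fieldMeasure P (j + 1) G) hΛ.measurable.aemeasurable (f := g)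
    (hg.aestronglyMeasurable.mono_measure (le_of_eq hΛ.map_eq))
  rw [hΛ.map_eq] at h
  exact h.symm

/-- ★★★ **FREE-SLOT LAUNDERING, SIGNED FORM.**  Slots `t(c) < L`; `f : fields → ℝ` integrable and blind to the slot bond of every segment; `g` a bounded measurable function of the
coarse field.  Then `∫ g(axialAvg U)·f(U) dU_j = (∫ g dU_{j+1})·(∫ f dU_j)` (standing range).  Route: for each coarse field `k` the slot shear preserves `dU_j` and fixes `f`, so the
left side equals `∫ g(Ū(U·ext k))·f(U) dU_j`; average over `k ∼ dU_{j+1}`, swap (Fubini: `|g| ≤ C`, `f` integrable), and use `integral_comp_axialAvg_shear`.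
[cite: Balaban1987RG1, (0.4) p.253; Balaban1985Averaging, (10) p.19] -/
theorem integral_comp_axialAvg_mul_eq_of_freeSlot (hj : j + 1 ≤ P.m + P.K) (t : PBond P (j + 1) → ℕ) (ht : ∀ c, t c < P.L)
    {f : GaugeField P j G → ℝ} (hf : Integrable f (fieldMeasure P j G))
    (hfree : ∀ (k : GaugeField P (j + 1) G) (U : GaugeField P j G),
      f (fun b => U b * Function.extend (fun c : PBond P (j + 1) => line c (t c)) k (fun _ => 1) b) = f U)
    {g : GaugeField P (j + 1) G → ℝ} (hg : Measurable g) (C : ℝ) (hgC : ∀ V, |g V| ≤ C) :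
    ∫ U, g (axialAvg U) * f U ∂(fieldMeasure P j G) =
      (∫ V, g V ∂(fieldMeasure P (j + 1) G)) * ∫ U, f U ∂(fieldMeasure P j G) := by
  have hmeas : Measurable (axialAvg : GaugeField P j G → GaugeField P (j + 1) G) := measurable_axialAvg
  set S : GaugeField P j G × GaugeField P (j + 1) G → GaugeField P j G := fun p b =>
    p.1 b * Function.extend (fun c : PBond P (j + 1) => line c (t c)) p.2 (fun _ => 1) b with hS
  have hSm : Measurable S := measurable_shear hj t ht
  -- the two-variable integrand
  set F : GaugeField P (j + 1) G → GaugeField P j G → ℝ := fun k U => g (axialAvg (S (U, k))) * f U with hF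
  -- (i) for each `k`, the shear does not change the integral
  have hstep : ∀ k : GaugeField P (j + 1) G,
      ∫ U, g (axialAvg U) * f U ∂(fieldMeasure P j G) = ∫ U, F k U ∂(fieldMeasure P j G) := by
    intro k
    have hR := measurePreserving_mulRight (P := P) (j := j) (G := G)
      (Function.extend (fun c : PBond P (j + 1) => line c (t c)) k (fun _ => 1))
    have hG : AEStronglyMeasurable (fun U : GaugeField P j G => g (axialAvg U) * f U) (fieldMeasure P j G) :=
      (hg.comp hmeas).aestronglyMeasurable.mul hf.aestronglyMeasurable
    have h1 := integral_map (μ := fieldMeasure P j G) hR.measurable.aemeasurable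
      (f := fun U : GaugeField P j G => g (axialAvg U) * f U) (hG.mono_measure (le_of_eq hR.map_eq))
    rw [hR.map_eq] at h1
    refine h1.trans (integral_congr_ae (Filter.Eventually.of_forall fun U => ?_))
    show g (axialAvg fun b => U b * _) * f (fun b => U b * _) = g (axialAvg (S (U, k))) * f U
    rw [hfree k U]
  -- (ii) average over `k`
  have havg : ∫ U, g (axialAvg U) * f U ∂(fieldMeasure P j G) =
      ∫ k, ∫ U, F k U ∂(fieldMeasure P j G) ∂(fieldMeasure P (j + 1) G) := by
    simp_rw [← hstep]
    rw [integral_const, probReal_univ, one_smul]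
  -- integrability of the uncurried integrand on the product
  have hFint : Integrable (Function.uncurry F) ((fieldMeasure P (j + 1) G).prod (fieldMeasure P j G)) := by
    have hf2 : Integrable (fun p : GaugeField P (j + 1) G × GaugeField P j G => f p.2)
        ((fieldMeasure P (j + 1) G).prod (fieldMeasure P j G)) := hf.comp_snd _
    have hgm : AEStronglyMeasurable (fun p : GaugeField P (j + 1) G × GaugeField P j G => g (axialAvg (S (p.2, p.1))))
        ((fieldMeasure P (j + 1) G).prod (fieldMeasure P j G)) :=
      (hg.comp (hmeas.comp (hSm.comp (measurable_snd.prodMk measurable_fst)))).aestronglyMeasurable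
    refine (hf2.bdd_mul (c := C) hgm (Filter.Eventually.of_forall fun p => ?_)).congr ?_
    · rw [Real.norm_eq_abs]; exact hgC _
    · exact Filter.Eventually.of_forall fun p => rfl
  rw [havg, integral_integral_swap hFint]
  -- (iii) inner integral over `k`
  have hinner : ∀ U : GaugeField P j G,
      ∫ k, F k U ∂(fieldMeasure P (j + 1) G) = (∫ V, g V ∂(fieldMeasure P (j + 1) G)) * f U := by
    intro U
    show ∫ k, g (axialAvg (S (U, k))) * f U ∂(fieldMeasure P (j + 1) G) = _
    rw [integral_mul_const]
    congr 1
    exact integral_comp_axialAvg_shear hj t ht U hg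
  simp_rw [hinner]
  rw [integral_const_mul]

/-- ★★ **READ-SET FORM**: `f` integrable reading only `R ⊆ PBond P j`, every segment with its slot outside `R`, `g` bounded measurable ⇒
`∫ g(ŪU)·f(U) dU_j = (∫ g dU_{j+1})·(∫ f dU_j)`. [cite: Balaban1987RG1, (0.4) p.253; Balaban1985Averaging, (10) p.19] -/
theorem integral_comp_axialAvg_mul_eq_of_readSet (hj : j + 1 ≤ P.m + P.K) (t : PBond P (j + 1) → ℕ) (ht : ∀ c, t c < P.L)
    {f : GaugeField P j G → ℝ} (hf : Integrable f (fieldMeasure P j G)) (R : Set (PBond P j))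
    (hR : ∀ U U' : GaugeField P j G, (∀ b ∈ R, U b = U' b) → f U = f U') (hslot : ∀ c, line c (t c) ∉ R)
    {g : GaugeField P (j + 1) G → ℝ} (hg : Measurable g) (C : ℝ) (hgC : ∀ V, |g V| ≤ C) :
    ∫ U, g (axialAvg U) * f U ∂(fieldMeasure P j G) =
      (∫ V, g V ∂(fieldMeasure P (j + 1) G)) * ∫ U, f U ∂(fieldMeasure P j G) := by
  refine integral_comp_axialAvg_mul_eq_of_freeSlot hj t ht hf (fun k U => hR _ _ fun b hb => ?_) hg C hgC
  have hb' : ¬ ∃ c, line c (t c) = b := by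
    rintro ⟨c, rfl⟩; exact hslot c hb
  show U b * Function.extend (fun c : PBond P (j + 1) => line c (t c)) k (fun _ => 1) b = U b
  rw [Function.extend_apply' _ _ _ hb', mul_one]

end Summit.QuantumFields.YangMills.Theorems.UV3AxialLaunderingFreeSlotIntegral

end
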